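import Literature.NumberTheory.Sieve.WelshCubicRootsGenerator
import Literature.NumberTheory.Sieve.WelshCubicRoots
import Mathlib.Algebra.Order.Archimedean.Basic
import HarnessLib

/-!
# Welsh 2018, Theorem 1 (Hooley's parametrisation of the roots of `X³ ≡ 2 (mod m)`): proof

Third support file for `Literature/NumberTheory/Sieve/WelshCubicRoots.lean`, following
M. C. Welsh, arXiv:1809.05211, §3–§5. From the generator `α = a + b2^{1/3} + c2^{2/3}` of the
ideal `(m, 2^{1/3} - ν)` (`WelshCubicRootsGenerator.exists_generator`) we
* normalise `α` by the units `±ε^k`, `ε = 1 + 2^{1/3} + 2^{2/3}` (Welsh's fundamental domain `𝒟`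
  of §5 (36), with his constant `C = 2`): real embedding `s ∈ (m^{1/3}/(2ε), m^{1/3}/2]`
  (`exists_normalised`);
* take Welsh's `u, v, w` of (22) — `mu = a+bν+cν²`, `mv = 2c+aν+bν²`, `mw = 2b+2cν+aν²` — and
  derive the Bezout relation (16), Lemma 2's formula (19) for `ν` (exactly, not only mod `m`),
  the six exact error identities of §4 (26) for the three pairwise intersections of the lines
  `bX+cY=u`, `aX+bY=v`, `2cX+aY=w`, and the size bounds of §5 ((33)–(35), (39)) with explicit
  constants (`1.25 < 2^{1/3} < 1.27`): `m^{2/3}/10 < A, B, C < 4m^{2/3}`, `|a|,|b|,|c| ≤ 120m^{1/3}`;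
* conclude `thm1_corrected_inner`: Theorem 1 with the absolute constant `120` and the CORRECTED
  second and third points `((cw-au)/B, (2cu-bw)/B)`, `((av-bw)/A, (aw-2cv)/A)` (the printed
  (24)/(37) have `v` for `w`, resp. `(u,v)` for `(v,w)`; the paper's own derivation (25)–(26) and
  its `γ⁻¹` in (18)/(53) give the corrected ones).
Real-variable inequalities are isolated in small lemmas (`window_of_realEmb`, `coeff_bounds`,
`coord_bound`, …) to keep `nlinarith` contexts small.

## References
* [Welsh2018CubicCongruenceSpacing] M. C. Welsh, arXiv:1809.05211 (2018), Lemma 2 (p. 7), §4 (p. 8),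
  §5 and Theorem 1 (p. 9).
* [Hooley1978CubicPrimeFactor] C. Hooley, J. reine angew. Math. 303/304 (1978) 21–50.
-/

noncomputable section

namespace Literature.NumberTheory.Sieve

namespace Welsh2018

/-! ### The unit group: normalising the real embedding (Welsh §5, the fundamental domain `𝒟`) -/

/-- Multiplication by the `k`-th power of the fundamental unit `ε = 1 + 2^{1/3} + 2^{2/3}` inside
`I_ν`: it preserves membership and the norm and multiplies the real embedding by `(1 + θ + θ²)^k`.
One step is `(a,b,c) ↦ (a + 2b + 2c, a + b + 2c, a + b + c)`.
[cite: Welsh2018CubicCongruenceSpacing, §3 eq. (10) (p. 7)] -/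
theorem exists_mul_eps_pow {θ : ℝ} (hθ : θ ^ 3 = 2) {m ν : ℤ} (hν : m ∣ ν ^ 3 - 2) (k : ℕ) :
    ∀ a b c : ℤ, m ∣ a + b * ν + c * ν ^ 2 → a ^ 3 + 2 * b ^ 3 + 4 * c ^ 3 - 6 * a * b * c = m →
      ∃ a' b' c' : ℤ, m ∣ a' + b' * ν + c' * ν ^ 2 ∧
        a' ^ 3 + 2 * b' ^ 3 + 4 * c' ^ 3 - 6 * a' * b' * c' = m ∧
        (a' : ℝ) + θ * b' + θ ^ 2 * c' = ((a : ℝ) + θ * b + θ ^ 2 * c) * (1 + θ + θ ^ 2) ^ k := by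
  induction k with
  | zero =>
    intro a b c h1 h2
    exact ⟨a, b, c, h1, h2, by simp⟩
  | succ k ih =>
    intro a b c h1 h2
    obtain ⟨a', b', c', h1', h2', h3'⟩ := ih a b c h1 h2
    refine ⟨a' + 2 * b' + 2 * c', a' + b' + 2 * c', a' + b' + c', ?_, ?_, ?_⟩
    · have e : (a' + 2 * b' + 2 * c') + (a' + b' + 2 * c') * ν + (a' + b' + c') * ν ^ 2
          = (1 + ν + ν ^ 2) * (a' + b' * ν + c' * ν ^ 2) - (ν ^ 3 - 2) * (b' + c' + c' * ν) := by
        ring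
      rw [e]; exact dvd_sub (dvd_mul_of_dvd_right h1' _) (dvd_mul_of_dvd_left hν _)
    · rw [← h2']; ring
    · have e : ((a' + 2 * b' + 2 * c' : ℤ) : ℝ) + θ * ((a' + b' + 2 * c' : ℤ) : ℝ)
          + θ ^ 2 * ((a' + b' + c' : ℤ) : ℝ)
          = ((a' : ℝ) + θ * b' + θ ^ 2 * c') * (1 + θ + θ ^ 2) := by
        push_cast
        linear_combination (-((b' : ℝ) + c' + c' * θ)) * hθ
      rw [e, h3', pow_succ]; ring

/-- Multiplication by the `k`-th power of `ε⁻¹ = 2^{1/3} - 1` inside `I_ν`: it preserves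
membership and the norm and multiplies the real embedding by `(θ - 1)^k`. One step is
`(a,b,c) ↦ (2c - a, a - b, b - c)`. [cite: Welsh2018CubicCongruenceSpacing, §3 eq. (10) (p. 7)] -/
theorem exists_mul_epsinv_pow {θ : ℝ} (hθ : θ ^ 3 = 2) {m ν : ℤ} (hν : m ∣ ν ^ 3 - 2) (k : ℕ) :
    ∀ a b c : ℤ, m ∣ a + b * ν + c * ν ^ 2 → a ^ 3 + 2 * b ^ 3 + 4 * c ^ 3 - 6 * a * b * c = m →
      ∃ a' b' c' : ℤ, m ∣ a' + b' * ν + c' * ν ^ 2 ∧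
        a' ^ 3 + 2 * b' ^ 3 + 4 * c' ^ 3 - 6 * a' * b' * c' = m ∧
        (a' : ℝ) + θ * b' + θ ^ 2 * c' = ((a : ℝ) + θ * b + θ ^ 2 * c) * (θ - 1) ^ k := by
  induction k with
  | zero =>
    intro a b c h1 h2
    exact ⟨a, b, c, h1, h2, by simp⟩
  | succ k ih =>
    intro a b c h1 h2
    obtain ⟨a', b', c', h1', h2', h3'⟩ := ih a b c h1 h2
    refine ⟨2 * c' - a', a' - b', b' - c', ?_, ?_, ?_⟩
    · have e : (2 * c' - a') + (a' - b') * ν + (b' - c') * ν ^ 2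
          = (ν - 1) * (a' + b' * ν + c' * ν ^ 2) - (ν ^ 3 - 2) * c' := by ring
      rw [e]; exact dvd_sub (dvd_mul_of_dvd_right h1' _) (dvd_mul_of_dvd_left hν _)
    · rw [← h2']; ring
    · have e : ((2 * c' - a' : ℤ) : ℝ) + θ * ((a' - b' : ℤ) : ℝ) + θ ^ 2 * ((b' - c' : ℤ) : ℝ)
          = ((a' : ℝ) + θ * b' + θ ^ 2 * c') * (θ - 1) := by
        push_cast
        linear_combination (-(c' : ℝ)) * hθ
      rw [e, h3', pow_succ]; ring

/-- The real embedding of an element of positive norm is positive: if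
`N(a,b,c) = m > 0` then `a + θb + θ²c > 0` (`4N = ℓ₁(ℓ₂² + 3ℓ₃²)`). [folklore] -/
theorem realEmb_pos {θ : ℝ} (hθ : θ ^ 3 = 2) {a b c m : ℝ} (hm : 0 < m)
    (hN : a ^ 3 + 2 * b ^ 3 + 4 * c ^ 3 - 6 * a * b * c = m) : 0 < a + θ * b + θ ^ 2 * c := by
  have hid := four_mul_normForm_eq hθ a b c
  have hW : 0 ≤ (2 * a - θ * b - θ ^ 2 * c) ^ 2 + 3 * (θ * b - θ ^ 2 * c) ^ 2 := by positivity
  by_contra hcon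
  rw [not_lt] at hcon
  have : (a + θ * b + θ ^ 2 * c) * ((2 * a - θ * b - θ ^ 2 * c) ^ 2 + 3 * (θ * b - θ ^ 2 * c) ^ 2)
      ≤ 0 := mul_nonpos_of_nonpos_of_nonneg hcon hW
  linarith

/-- **Normalised generator (Welsh's choice `α ∈ 𝒟`, §5 eq. (36), p. 9).** For `m ≥ 1`,
`m ∣ ν³ - 2`, `θ³ = 2`, `μ³ = m`, there is `(a,b,c) ∈ I_ν` of norm `m` whose real embedding
`s = a + θb + θ²c` lies in `(μ/(2ε₁), μ/2]`, `ε₁ = 1 + θ + θ²` — equivalently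
`m/s = A + θB + θ²C ∈ [2m^{2/3}, 2ε₁m^{2/3})`, Welsh's `α⁻¹ ∈ 𝒟₁` with his constant `C = 2`.
[cite: Welsh2018CubicCongruenceSpacing, §5 (30)–(36) (p. 9)] -/
theorem exists_normalised {θ μ : ℝ} (hθ : θ ^ 3 = 2) (hθ0 : 0 < θ) (m : ℕ) (hm : 1 ≤ m)
    (hμ0 : 0 < μ) (ν : ℤ) (hν : (m : ℤ) ∣ ν ^ 3 - 2) :
    ∃ a b c : ℤ, (m : ℤ) ∣ a + b * ν + c * ν ^ 2 ∧
      a ^ 3 + 2 * b ^ 3 + 4 * c ^ 3 - 6 * a * b * c = m ∧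
      μ / (2 * (1 + θ + θ ^ 2)) < (a : ℝ) + θ * b + θ ^ 2 * c ∧
      (a : ℝ) + θ * b + θ ^ 2 * c ≤ μ / 2 := by
  obtain ⟨a, b, c, hmem, hN⟩ := exists_generator m hm ν hν
  set ε₁ : ℝ := 1 + θ + θ ^ 2 with hε₁
  have hε₁1 : 1 < ε₁ := by rw [hε₁]; nlinarith
  have hε₁0 : 0 < ε₁ := by linarith
  have hinv : (θ - 1) * ε₁ = 1 := by rw [hε₁]; linear_combination hθ
  have hθ1 : 0 < θ - 1 := by
    by_contra hcon
    rw [not_lt] at hcon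
    have : (θ - 1) * ε₁ ≤ 0 := mul_nonpos_of_nonpos_of_nonneg hcon hε₁0.le
    linarith
  set s : ℝ := (a : ℝ) + θ * b + θ ^ 2 * c with hs
  have hmpos : (0 : ℝ) < m := by exact_mod_cast hm
  have hs0 : 0 < s := by
    refine realEmb_pos hθ hmpos ?_
    exact_mod_cast hN
  obtain ⟨n, hn1, hn2⟩ := exists_mem_Ioc_zpow (show 0 < 2 * ε₁ * s / μ by positivity) hε₁1
  obtain ⟨k, rfl | rfl⟩ := Int.eq_nat_or_neg n
  · -- `n = k ≥ 0`: multiply by `ε⁻¹` `k` times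
    obtain ⟨a', b', c', h1, h2, h3⟩ := exists_mul_epsinv_pow hθ hν k a b c hmem hN
    have hpk : (θ - 1) ^ k * ε₁ ^ k = 1 := by rw [← mul_pow, hinv, one_pow]
    have hθk : 0 < (θ - 1) ^ k := pow_pos hθ1 k
    refine ⟨a', b', c', h1, h2, ?_, ?_⟩
    · rw [h3, ← hs]
      rw [zpow_natCast, lt_div_iff₀ hμ0] at hn1
      rw [div_lt_iff₀ (by positivity)]
      calc μ = (ε₁ ^ k * μ) * (θ - 1) ^ k := by linear_combination (-μ) * hpk
        _ < (2 * ε₁ * s) * (θ - 1) ^ k := mul_lt_mul_of_pos_right hn1 hθk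
        _ = s * (θ - 1) ^ k * (2 * (1 + θ + θ ^ 2)) := by rw [hε₁]; ring
    · rw [h3, ← hs]
      rw [zpow_add_one₀ hε₁0.ne', zpow_natCast, div_le_iff₀ hμ0] at hn2
      have h2s : 2 * s ≤ ε₁ ^ k * μ := by
        have h' : ε₁ * (2 * s) ≤ ε₁ * (ε₁ ^ k * μ) := by linarith
        exact le_of_mul_le_mul_left h' hε₁0
      rw [le_div_iff₀ (by norm_num : (0 : ℝ) < 2)]
      calc s * (θ - 1) ^ k * 2 = (2 * s) * (θ - 1) ^ k := by ring
        _ ≤ (ε₁ ^ k * μ) * (θ - 1) ^ k := mul_le_mul_of_nonneg_right h2s hθk.le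
        _ = μ := by linear_combination μ * hpk
  · -- `n = -k ≤ 0`: multiply by `ε` `k` times
    obtain ⟨a', b', c', h1, h2, h3⟩ := exists_mul_eps_pow hθ hν k a b c hmem hN
    have hek : 0 < ε₁ ^ k := by positivity
    refine ⟨a', b', c', h1, h2, ?_, ?_⟩
    · rw [h3, ← hs, ← hε₁]
      rw [zpow_neg, zpow_natCast] at hn1
      have h1' : μ < 2 * ε₁ * s * ε₁ ^ k := by
        have h' := mul_lt_mul_of_pos_right hn1 (show 0 < μ * ε₁ ^ k by positivity)
        have e1 : (ε₁ ^ k)⁻¹ * (μ * ε₁ ^ k) = μ := by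
          rw [mul_comm μ, ← mul_assoc, inv_mul_cancel₀ hek.ne', one_mul]
        have e2 : 2 * ε₁ * s / μ * (μ * ε₁ ^ k) = 2 * ε₁ * s * ε₁ ^ k := by
          rw [← mul_assoc, div_mul_cancel₀ _ hμ0.ne']
        rw [e1, e2] at h'
        exact h'
      rw [div_lt_iff₀ (by positivity)]
      linarith
    · rw [h3, ← hs, ← hε₁]
      rw [zpow_add_one₀ hε₁0.ne', zpow_neg, zpow_natCast] at hn2
      have h1' : 2 * ε₁ * s * ε₁ ^ k ≤ ε₁ * μ := by
        have h' := mul_le_mul_of_nonneg_right hn2 (show 0 ≤ μ * ε₁ ^ k by positivity)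
        have e1 : 2 * ε₁ * s / μ * (μ * ε₁ ^ k) = 2 * ε₁ * s * ε₁ ^ k := by
          rw [← mul_assoc, div_mul_cancel₀ _ hμ0.ne']
        have e2 : (ε₁ ^ k)⁻¹ * ε₁ * (μ * ε₁ ^ k) = ε₁ * μ := by
          calc (ε₁ ^ k)⁻¹ * ε₁ * (μ * ε₁ ^ k) = ((ε₁ ^ k)⁻¹ * ε₁ ^ k) * (ε₁ * μ) := by ring
            _ = ε₁ * μ := by rw [inv_mul_cancel₀ hek.ne', one_mul]
        rw [e1, e2] at h'
        exact h'
      have h2s : 2 * s * ε₁ ^ k ≤ μ := by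
        have h' : ε₁ * (2 * s * ε₁ ^ k) ≤ ε₁ * μ := by linarith
        exact le_of_mul_le_mul_left h' hε₁0
      rw [le_div_iff₀ (by norm_num : (0 : ℝ) < 2)]
      linarith

/-! ### Theorem 1 (corrected points), with the absolute constant `120`: real-variable lemmas -/

/-- The window for `X = m/s`: from `s ∈ (μ/(2e), μ/2]`, `e < 3.9`, get `X ∈ [2μ², 7.8μ²)`.
[cite: Welsh2018CubicCongruenceSpacing, §5 (30) (p. 9)] -/
theorem window_of_realEmb {s X μ e : ℝ} (hμ0 : 0 < μ) (hs0 : 0 < s) (hsX : s * X = μ ^ 3)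
    (he : 0 < e) (he' : e < 3.9) (hs1 : μ / (2 * e) < s) (hs2 : s ≤ μ / 2) :
    2 * μ ^ 2 ≤ X ∧ X < 7.8 * μ ^ 2 := by
  have hX : X = μ ^ 3 / s := by
    rw [eq_div_iff hs0.ne']; linarith
  rw [hX, le_div_iff₀ hs0, div_lt_iff₀ hs0]
  rw [div_lt_iff₀ (by positivity)] at hs1
  constructor
  · nlinarith
  · have h1 : μ < 7.8 * s := by nlinarith
    nlinarith [mul_lt_mul_of_pos_right h1 (by positivity : 0 < μ ^ 2)]

/-- **Sizes of `A, B, C` (Welsh §5, (31)–(35) with `C = 2`).** If `X ∈ [2μ², 7.8μ²)`,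
`X·W = 4μ⁶` and `W` dominates `(3A - X)², (3θB - X)², (3θ²C - X)²` (the three ways of writing
`4|σ₂|² = (2 Re)² + (2 Im)²`), then `μ²/10 < A, B, C < 4μ²` (`1.25 < θ < 1.27`).
[cite: Welsh2018CubicCongruenceSpacing, §5 (33)–(35) (p. 9)] -/
theorem coeff_bounds {θ μ A B C X W : ℝ} (hθlo : 1.25 < θ) (hθup : θ < 1.27) (hμ0 : 0 < μ)
    (hXlo : 2 * μ ^ 2 ≤ X) (hXhi : X < 7.8 * μ ^ 2) (hXW : X * W = 4 * μ ^ 6)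
    (hW1 : (3 * A - X) ^ 2 ≤ W) (hW2 : (3 * (θ * B) - X) ^ 2 ≤ W)
    (hW3 : (3 * (θ ^ 2 * C) - X) ^ 2 ≤ W) :
    μ ^ 2 / 10 < A ∧ A < 4 * μ ^ 2 ∧ μ ^ 2 / 10 < B ∧ B < 4 * μ ^ 2 ∧
      μ ^ 2 / 10 < C ∧ C < 4 * μ ^ 2 := by
  have hμ2 : 0 < μ ^ 2 := by positivity
  have hXpos : 0 < X := lt_of_lt_of_le (by positivity) hXlo
  have hWle : W ≤ 2 * μ ^ 4 := by
    have h1 : W * X ≤ 2 * μ ^ 4 * X := by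
      nlinarith [mul_le_mul_of_nonneg_left hXlo (show 0 ≤ 2 * μ ^ 4 by positivity)]
    exact le_of_mul_le_mul_right h1 hXpos
  have hbound : ∀ t : ℝ, t ^ 2 ≤ W → |t| < 1.5 * μ ^ 2 := by
    intro t ht
    refine abs_lt_of_sq_lt_sq ?_ (by positivity)
    nlinarith
  obtain ⟨hA3l, hA3u⟩ := abs_lt.mp (hbound _ hW1)
  obtain ⟨hB3l, hB3u⟩ := abs_lt.mp (hbound _ hW2)
  obtain ⟨hC3l, hC3u⟩ := abs_lt.mp (hbound _ hW3)
  have hθ0 : 0 < θ := by linarith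
  have hBpos : 0 < B := pos_of_mul_pos_right (by linarith : 0 < θ * B) hθ0.le
  have hCpos : 0 < C := pos_of_mul_pos_right (by linarith : 0 < θ ^ 2 * C) (by positivity)
  have hθ2u : θ ^ 2 < 1.62 := by nlinarith
  have hθ2l : 1.56 < θ ^ 2 := by nlinarith
  refine ⟨by linarith, by linarith, ?_, ?_, ?_, ?_⟩
  · nlinarith [mul_lt_mul_of_pos_right hθup hBpos]
  · nlinarith [mul_lt_mul_of_pos_right hθlo hBpos]
  · nlinarith [mul_lt_mul_of_pos_right hθ2u hCpos]
  · nlinarith [mul_lt_mul_of_pos_right hθ2l hCpos]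

/-- Sizes of `a, b, c` from `m·a = A² - 2BC` etc. (Welsh (39)): if `t·μ³ = P - Q` with
`0 ≤ P, Q < 32μ⁴` then `|t| ≤ 120μ`. [cite: Welsh2018CubicCongruenceSpacing, §5 (39) (p. 9)] -/
theorem coord_bound {t P Q μ : ℝ} (hμ0 : 0 < μ) (ht : t * μ ^ 3 = P - Q) (hP : 0 ≤ P)
    (hQ : 0 ≤ Q) (hP' : P < 32 * μ ^ 4) (hQ' : Q < 32 * μ ^ 4) : |t| ≤ 120 * μ := by
  have hμ3 : 0 < μ ^ 3 := by positivity
  have h1 : |t| * μ ^ 3 ≤ 64 * μ ^ 4 := by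
    rw [← abs_of_pos hμ3, ← abs_mul, ht]
    have h2 := abs_sub P Q
    rw [abs_of_nonneg hP, abs_of_nonneg hQ] at h2
    linarith
  have h3 : |t| ≤ 64 * μ := by
    by_contra hcon
    rw [not_le] at hcon
    nlinarith [mul_lt_mul_of_pos_right hcon hμ3]
  linarith [abs_nonneg t]

/-- A quadratic-mean step used for the torus distances: if `|x| ≤ p/m` and `|y| ≤ q/m` with
`p² + q² ≤ 120²` then `x² + y² ≤ (120/m)²`. [folklore] -/
theorem sq_add_sq_le {x y p q m : ℝ} (hx : |x| ≤ p / m) (hy : |y| ≤ q / m)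
    (hpq : p ^ 2 + q ^ 2 ≤ 120 ^ 2) : x ^ 2 + y ^ 2 ≤ (120 / m) ^ 2 := by
  have hx2 : x ^ 2 ≤ (p / m) ^ 2 := by
    rw [← sq_abs x]; exact pow_le_pow_left₀ (abs_nonneg x) hx 2
  have hy2 : y ^ 2 ≤ (q / m) ^ 2 := by
    rw [← sq_abs y]; exact pow_le_pow_left₀ (abs_nonneg y) hy 2
  have e : (p / m) ^ 2 + (q / m) ^ 2 = (p ^ 2 + q ^ 2) * (1 / m) ^ 2 := by ring
  have e' : (120 / m) ^ 2 = 120 ^ 2 * (1 / m) ^ 2 := by ring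
  have h0 : 0 ≤ (1 / m) ^ 2 := by positivity
  calc x ^ 2 + y ^ 2 ≤ (p / m) ^ 2 + (q / m) ^ 2 := add_le_add hx2 hy2
    _ = (p ^ 2 + q ^ 2) * (1 / m) ^ 2 := e
    _ ≤ 120 ^ 2 * (1 / m) ^ 2 := mul_le_mul_of_nonneg_right hpq h0
    _ = (120 / m) ^ 2 := e'.symm

/-- Ratio bound: for `0 < m`, `0 < D`, `0 ≤ P` and `P ≤ k·D`, `|-(P/(m·D))| ≤ k/m`. [folklore] -/
theorem abs_neg_div_le {P D m k : ℝ} (hm : 0 < m) (hD : 0 < D) (hP : 0 ≤ P) (h : P ≤ k * D) :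
    |-(P / (m * D))| ≤ k / m := by
  rw [abs_neg, abs_of_nonneg (by positivity), div_le_div_iff₀ (by positivity) hm]
  nlinarith

/-- The exact error identity of §4 (26): if `num·m = -P + e·D` with `D ≠ 0`, `m ≠ 0`, then
`num/D - e/m = -(P/(m·D))`. [cite: Welsh2018CubicCongruenceSpacing, §4 (26) (p. 8)] -/
theorem err_identity {num D P e m : ℝ} (hm : m ≠ 0) (hD : D ≠ 0) (h : num * m = -P + e * D) :
    num / D - e / m = -(P / (m * D)) := by
  field_simp
  linarith

/-! ### Theorem 1 (corrected points), with the absolute constant `120` -/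

/-- **Welsh 2018, Theorem 1 (with Lemma 2 and the bounds of §5), corrected second and third
points, explicit constant `C = 120`.** For `m ≥ 1` and `m ∣ ν³ - 2` there are integers
`a b c u v w` with: `m = N(a,b,c)`; the Bezout relation (16); Lemma 2's congruence (19) for `ν`
(here even `ν = 2uC + vA + wB` exactly, `A = a²-2bc`, `B = 2c²-ab`, `C = b²-ac`, with Welsh's
`u, v, w` of (22): `mu = a+bν+cν²`, `mv = 2c+aν+bν²`, `mw = 2b+2cν+aν²`); `|a|,|b|,|c| ≤ 120m^{1/3}`;
`m^{2/3}/120 ≤ A, B, C ≤ 120m^{2/3}`; and the three pairwise intersections of the lines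
`bX + cY = u`, `aX + bY = v`, `2cX + aY = w` of §4 — `((bu-cv)/C, (bv-au)/C)`,
`((cw-au)/B, (2cu-bw)/B)`, `((av-bw)/A, (aw-2cv)/A)` — are within `120/m` of `(ν/m, ν²/m)`
(exactly: the errors are `(-B, -A)/(mC)`, `(-A, -2C)/(mB)`, `(-2C, -2B)/(mA)`, eq. (26)).
The printed (24)/(37) carry `v` for `w` in the second point and `(u,v)` for `(v,w)` in the third.
[cite: Welsh2018CubicCongruenceSpacing, Thm 1 (p. 9), Lemma 2 (p. 7), §4 (22)–(26), §5 (39)] -/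
theorem thm1_corrected_inner (m : ℕ) (ν : ℤ) (hm : 1 ≤ m) (hν : (m : ℤ) ∣ ν ^ 3 - 2) :
    ∃ a b c u v w : ℤ,
      (m : ℤ) = a ^ 3 + 2 * b ^ 3 + 4 * c ^ 3 - 6 * a * b * c ∧
      u * (a ^ 2 - 2 * b * c) + v * (2 * c ^ 2 - a * b) + w * (b ^ 2 - a * c) = 1 ∧
      (m : ℤ) ∣ ν + (a * (b * w - a * v) + 2 * c * (a * u - c * w) + 2 * b * (c * v - b * u)) ∧
      (|(a : ℝ)| ≤ 120 * (m : ℝ) ^ ((1 : ℝ) / 3) ∧ |(b : ℝ)| ≤ 120 * (m : ℝ) ^ ((1 : ℝ) / 3) ∧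
        |(c : ℝ)| ≤ 120 * (m : ℝ) ^ ((1 : ℝ) / 3)) ∧
      ((m : ℝ) ^ ((2 : ℝ) / 3) / 120 ≤ |((b ^ 2 - a * c : ℤ) : ℝ)| ∧
        |((b ^ 2 - a * c : ℤ) : ℝ)| ≤ 120 * (m : ℝ) ^ ((2 : ℝ) / 3) ∧
        (m : ℝ) ^ ((2 : ℝ) / 3) / 120 ≤ |((2 * c ^ 2 - a * b : ℤ) : ℝ)| ∧
        |((2 * c ^ 2 - a * b : ℤ) : ℝ)| ≤ 120 * (m : ℝ) ^ ((2 : ℝ) / 3) ∧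
        (m : ℝ) ^ ((2 : ℝ) / 3) / 120 ≤ |((a ^ 2 - 2 * b * c : ℤ) : ℝ)| ∧
        |((a ^ 2 - 2 * b * c : ℤ) : ℝ)| ≤ 120 * (m : ℝ) ^ ((2 : ℝ) / 3)) ∧
      TorusClose (120 / m) (((b * u - c * v : ℤ) : ℝ) / ((b ^ 2 - a * c : ℤ) : ℝ))
        (((b * v - a * u : ℤ) : ℝ) / ((b ^ 2 - a * c : ℤ) : ℝ)) ((ν : ℝ) / m) ((ν : ℝ) ^ 2 / m) ∧
      TorusClose (120 / m) (((c * w - a * u : ℤ) : ℝ) / ((2 * c ^ 2 - a * b : ℤ) : ℝ))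
        (((2 * c * u - b * w : ℤ) : ℝ) / ((2 * c ^ 2 - a * b : ℤ) : ℝ)) ((ν : ℝ) / m)
        ((ν : ℝ) ^ 2 / m) ∧
      TorusClose (120 / m) (((a * v - b * w : ℤ) : ℝ) / ((a ^ 2 - 2 * b * c : ℤ) : ℝ))
        (((a * w - 2 * c * v : ℤ) : ℝ) / ((a ^ 2 - 2 * b * c : ℤ) : ℝ)) ((ν : ℝ) / m)
        ((ν : ℝ) ^ 2 / m) := by
  -- the real cube roots
  set θ : ℝ := (2 : ℝ) ^ ((1 : ℝ) / 3) with hθdef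
  have hθ : θ ^ 3 = 2 := by
    rw [hθdef, ← Real.rpow_natCast, ← Real.rpow_mul (by norm_num)]; norm_num
  have hθ0 : 0 < θ := Real.rpow_pos_of_pos (by norm_num) _
  have hmpos : (0 : ℝ) < m := by exact_mod_cast hm
  set μ : ℝ := (m : ℝ) ^ ((1 : ℝ) / 3) with hμdef
  have hμ : μ ^ 3 = m := by
    rw [hμdef, ← Real.rpow_natCast, ← Real.rpow_mul hmpos.le]; norm_num
  have hμ0 : 0 < μ := Real.rpow_pos_of_pos hmpos _
  have hμ2 : (m : ℝ) ^ ((2 : ℝ) / 3) = μ ^ 2 := by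
    rw [hμdef, ← Real.rpow_natCast, ← Real.rpow_mul hmpos.le]; norm_num
  have hθup : θ < 1.27 := lt_of_pow_lt_pow_left₀ 3 (by norm_num) (by rw [hθ]; norm_num)
  have hθlo : 1.25 < θ := lt_of_pow_lt_pow_left₀ 3 hθ0.le (by rw [hθ]; norm_num)
  -- the normalised generator and Welsh's `u, v, w`
  obtain ⟨a, b, c, hmem, hN, hs1, hs2⟩ := exists_normalised hθ hθ0 m hm hμ0 ν hν
  have hm0 : (m : ℤ) ≠ 0 := by exact_mod_cast (show m ≠ 0 by omega)
  obtain ⟨u, hu⟩ := hmem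
  obtain ⟨v, hv⟩ : (m : ℤ) ∣ 2 * c + a * ν + b * ν ^ 2 := by
    have e : 2 * c + a * ν + b * ν ^ 2 = ν * (a + b * ν + c * ν ^ 2) - c * (ν ^ 3 - 2) := by ring
    rw [e]; exact dvd_sub (dvd_mul_of_dvd_right ⟨u, hu⟩ _) (dvd_mul_of_dvd_right hν _)
  obtain ⟨w, hw⟩ : (m : ℤ) ∣ 2 * b + 2 * c * ν + a * ν ^ 2 := by
    have e : 2 * b + 2 * c * ν + a * ν ^ 2 = ν * (2 * c + a * ν + b * ν ^ 2) - b * (ν ^ 3 - 2) := by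
      ring
    rw [e]; exact dvd_sub (dvd_mul_of_dvd_right ⟨v, hv⟩ _) (dvd_mul_of_dvd_right hν _)
  -- integer identities
  have hBez : u * (a ^ 2 - 2 * b * c) + v * (2 * c ^ 2 - a * b) + w * (b ^ 2 - a * c) = 1 := by
    refine mul_left_cancel₀ hm0 ?_
    have e : (m : ℤ) * (u * (a ^ 2 - 2 * b * c) + v * (2 * c ^ 2 - a * b) + w * (b ^ 2 - a * c))
        = (m * u) * (a ^ 2 - 2 * b * c) + (m * v) * (2 * c ^ 2 - a * b)
          + (m * w) * (b ^ 2 - a * c) := by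
      ring
    rw [e, ← hu, ← hv, ← hw, mul_one, ← hN]; ring
  have hνeq : ν = 2 * u * (b ^ 2 - a * c) + v * (a ^ 2 - 2 * b * c) + w * (2 * c ^ 2 - a * b) := by
    refine mul_left_cancel₀ hm0 ?_
    have e : (m : ℤ) * (2 * u * (b ^ 2 - a * c) + v * (a ^ 2 - 2 * b * c) + w * (2 * c ^ 2 - a * b))
        = 2 * (m * u) * (b ^ 2 - a * c) + (m * v) * (a ^ 2 - 2 * b * c)
          + (m * w) * (2 * c ^ 2 - a * b) := by
      ring
    rw [e, ← hu, ← hv, ← hw, ← hN]; ring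
  have i1 : (b * u - c * v) * (m : ℤ) = -(2 * c ^ 2 - a * b) + ν * (b ^ 2 - a * c) := by
    have e : (b * u - c * v) * (m : ℤ) = b * (m * u) - c * (m * v) := by ring
    rw [e, ← hu, ← hv]; ring
  have i2 : (b * v - a * u) * (m : ℤ) = -(a ^ 2 - 2 * b * c) + ν ^ 2 * (b ^ 2 - a * c) := by
    have e : (b * v - a * u) * (m : ℤ) = b * (m * v) - a * (m * u) := by ring
    rw [e, ← hu, ← hv]; ring
  have i3 : (c * w - a * u) * (m : ℤ) = -(a ^ 2 - 2 * b * c) + ν * (2 * c ^ 2 - a * b) := by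
    have e : (c * w - a * u) * (m : ℤ) = c * (m * w) - a * (m * u) := by ring
    rw [e, ← hu, ← hw]; ring
  have i4 : (2 * c * u - b * w) * (m : ℤ) = -(2 * (b ^ 2 - a * c)) + ν ^ 2 * (2 * c ^ 2 - a * b) := by
    have e : (2 * c * u - b * w) * (m : ℤ) = 2 * c * (m * u) - b * (m * w) := by ring
    rw [e, ← hu, ← hw]; ring
  have i5 : (a * v - b * w) * (m : ℤ) = -(2 * (b ^ 2 - a * c)) + ν * (a ^ 2 - 2 * b * c) := by
    have e : (a * v - b * w) * (m : ℤ) = a * (m * v) - b * (m * w) := by ring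
    rw [e, ← hv, ← hw]; ring
  have i6 : (a * w - 2 * c * v) * (m : ℤ)
      = -(2 * (2 * c ^ 2 - a * b)) + ν ^ 2 * (a ^ 2 - 2 * b * c) := by
    have e : (a * w - 2 * c * v) * (m : ℤ) = a * (m * w) - 2 * c * (m * v) := by ring
    rw [e, ← hv, ← hw]; ring
  -- real variables
  obtain ⟨A, hA⟩ : ∃ A : ℝ, A = ((a ^ 2 - 2 * b * c : ℤ) : ℝ) := ⟨_, rfl⟩
  obtain ⟨B, hB⟩ : ∃ B : ℝ, B = ((2 * c ^ 2 - a * b : ℤ) : ℝ) := ⟨_, rfl⟩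
  obtain ⟨C, hC⟩ : ∃ C : ℝ, C = ((b ^ 2 - a * c : ℤ) : ℝ) := ⟨_, rfl⟩
  have hA' : A = (a : ℝ) ^ 2 - 2 * b * c := by rw [hA]; push_cast; ring
  have hB' : B = 2 * (c : ℝ) ^ 2 - a * b := by rw [hB]; push_cast; ring
  have hC' : C = (b : ℝ) ^ 2 - a * c := by rw [hC]; push_cast; ring
  have hNr : (a : ℝ) ^ 3 + 2 * b ^ 3 + 4 * c ^ 3 - 6 * a * b * c = m := by exact_mod_cast hN
  obtain ⟨s, hs⟩ : ∃ s : ℝ, s = (a : ℝ) + θ * b + θ ^ 2 * c := ⟨_, rfl⟩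
  obtain ⟨X, hX⟩ : ∃ X : ℝ, X = A + θ * B + θ ^ 2 * C := ⟨_, rfl⟩
  rw [← hs] at hs1 hs2
  have hs0 : 0 < s := lt_trans (by positivity) hs1
  -- `s · X = N = m = μ³`
  have hsX : s * X = μ ^ 3 := by
    rw [hs, hX, hA', hB', hC', hμ, ← hNr]
    linear_combination ((b : ℝ) ^ 3 + 2 * c ^ 3 - 2 * a * b * c + (b ^ 2 * c - a * c ^ 2) * θ) * hθ
  -- the window for `X`
  have hθθ : θ * θ < 1.27 * 1.27 := mul_lt_mul'' hθup hθup hθ0.le hθ0.le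
  have hε : 1 + θ + θ ^ 2 < 3.9 := by rw [sq]; linarith
  obtain ⟨hXlo, hXhi⟩ :=
    window_of_realEmb hμ0 hs0 hsX (by positivity : (0 : ℝ) < 1 + θ + θ ^ 2) hε hs1 hs2
  -- `X · W = 4 m²` with `W ≥ (3A - X)², (3θB - X)², (3θ²C - X)²`
  obtain ⟨W, hW⟩ : ∃ W : ℝ, W = (2 * A - θ * B - θ ^ 2 * C) ^ 2 + 3 * (θ * B - θ ^ 2 * C) ^ 2 :=
    ⟨_, rfl⟩
  have hNA : A ^ 3 + 2 * B ^ 3 + 4 * C ^ 3 - 6 * A * B * C = (m : ℝ) ^ 2 := by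
    rw [hA', hB', hC', ← hNr]; ring
  have hXW : X * W = 4 * μ ^ 6 := by
    have h4 := four_mul_normForm_eq hθ A B C
    rw [hNA] at h4
    rw [hX, hW, ← h4, ← hμ]; ring
  have hW1 : (3 * A - X) ^ 2 ≤ W := by
    have e : W = (3 * A - X) ^ 2 + 3 * (θ * B - θ ^ 2 * C) ^ 2 := by rw [hW, hX]; ring
    rw [e]; exact le_add_of_nonneg_right (by positivity)
  have hW2 : (3 * (θ * B) - X) ^ 2 ≤ W := by
    have e : W = (3 * (θ * B) - X) ^ 2 + 3 * (A - θ ^ 2 * C) ^ 2 := by rw [hW, hX]; ring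
    rw [e]; exact le_add_of_nonneg_right (by positivity)
  have hW3 : (3 * (θ ^ 2 * C) - X) ^ 2 ≤ W := by
    have e : W = (3 * (θ ^ 2 * C) - X) ^ 2 + 3 * (A - θ * B) ^ 2 := by rw [hW, hX]; ring
    rw [e]; exact le_add_of_nonneg_right (by positivity)
  obtain ⟨hAlo, hAhi, hBlo, hBhi, hClo, hChi⟩ :=
    coeff_bounds hθlo hθup hμ0 hXlo hXhi hXW hW1 hW2 hW3
  have hμsq : 0 < μ ^ 2 := by positivity
  have hApos : 0 < A := lt_trans (by positivity) hAlo
  have hBpos : 0 < B := lt_trans (by positivity) hBlo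
  have hCpos : 0 < C := lt_trans (by positivity) hClo
  -- sizes of `a, b, c` via `m·a = A² - 2BC`, `m·b = 2C² - AB`, `m·c = B² - AC` (eq. (39))
  have ha : (a : ℝ) * μ ^ 3 = A ^ 2 - 2 * B * C := by rw [hA', hB', hC', hμ, ← hNr]; ring
  have hb : (b : ℝ) * μ ^ 3 = 2 * C ^ 2 - A * B := by rw [hA', hB', hC', hμ, ← hNr]; ring
  have hc : (c : ℝ) * μ ^ 3 = B ^ 2 - A * C := by rw [hA', hB', hC', hμ, ← hNr]; ring
  have hμ4 : 0 < μ ^ 4 := by positivity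
  have e16 : (4 * μ ^ 2) * (4 * μ ^ 2) = 16 * μ ^ 4 := by ring
  have pAA := mul_lt_mul'' hAhi hAhi hApos.le hApos.le
  have pBB := mul_lt_mul'' hBhi hBhi hBpos.le hBpos.le
  have pCC := mul_lt_mul'' hChi hChi hCpos.le hCpos.le
  have pAB := mul_lt_mul'' hAhi hBhi hApos.le hBpos.le
  have pAC := mul_lt_mul'' hAhi hChi hApos.le hCpos.le
  have pBC := mul_lt_mul'' hBhi hChi hBpos.le hCpos.le
  have qA : A ^ 2 < 32 * μ ^ 4 := by rw [sq]; linarith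
  have q2C : 2 * C ^ 2 < 32 * μ ^ 4 := by rw [sq]; linarith
  have qB : B ^ 2 < 32 * μ ^ 4 := by rw [sq]; linarith
  have q2BC : 2 * B * C < 32 * μ ^ 4 := by linarith
  have qAB : A * B < 32 * μ ^ 4 := by linarith
  have qAC : A * C < 32 * μ ^ 4 := by linarith
  have haB : |(a : ℝ)| ≤ 120 * μ :=
    coord_bound hμ0 ha (by positivity) (by positivity) qA q2BC
  have hbB : |(b : ℝ)| ≤ 120 * μ :=
    coord_bound hμ0 hb (by positivity) (by positivity) q2C qAB
  have hcB : |(c : ℝ)| ≤ 120 * μ :=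
    coord_bound hμ0 hc (by positivity) (by positivity) qB qAC
  -- the torus distances: exact error terms
  have hmR0 : (m : ℝ) ≠ 0 := hmpos.ne'
  have cast1 : (((b * u - c * v : ℤ) : ℝ)) * m = -B + ν * C := by
    rw [hB, hC]; exact_mod_cast i1
  have cast2 : (((b * v - a * u : ℤ) : ℝ)) * m = -A + (ν : ℝ) ^ 2 * C := by
    rw [hA, hC]; exact_mod_cast i2
  have cast3 : (((c * w - a * u : ℤ) : ℝ)) * m = -A + ν * B := by
    rw [hA, hB]; exact_mod_cast i3
  have cast4 : (((2 * c * u - b * w : ℤ) : ℝ)) * m = -(2 * C) + (ν : ℝ) ^ 2 * B := by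
    rw [hB, hC]; exact_mod_cast i4
  have cast5 : (((a * v - b * w : ℤ) : ℝ)) * m = -(2 * C) + ν * A := by
    rw [hA, hC]; exact_mod_cast i5
  have cast6 : (((a * w - 2 * c * v : ℤ) : ℝ)) * m = -(2 * B) + (ν : ℝ) ^ 2 * A := by
    rw [hA, hB]; exact_mod_cast i6
  have e1 := err_identity hmR0 hCpos.ne' cast1
  have e2 := err_identity hmR0 hCpos.ne' cast2
  have e3 := err_identity hmR0 hBpos.ne' cast3
  have e4 := err_identity hmR0 hBpos.ne' cast4
  have e5 := err_identity hmR0 hApos.ne' cast5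
  have e6 := err_identity hmR0 hApos.ne' cast6
  have d1 : |-(B / (m * C))| ≤ 40 / m := abs_neg_div_le hmpos hCpos hBpos.le (by linarith)
  have d2 : |-(A / (m * C))| ≤ 40 / m := abs_neg_div_le hmpos hCpos hApos.le (by linarith)
  have d3 : |-(A / (m * B))| ≤ 40 / m := abs_neg_div_le hmpos hBpos hApos.le (by linarith)
  have d4 : |-(2 * C / (m * B))| ≤ 80 / m :=
    abs_neg_div_le hmpos hBpos (by positivity) (by linarith)
  have d5 : |-(2 * C / (m * A))| ≤ 80 / m :=
    abs_neg_div_le hmpos hApos (by positivity) (by linarith)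
  have d6 : |-(2 * B / (m * A))| ≤ 80 / m :=
    abs_neg_div_le hmpos hApos (by positivity) (by linarith)
  -- assemble
  refine ⟨a, b, c, u, v, w, hN.symm, hBez, ?_, ?_, ?_, ?_, ?_, ?_⟩
  · rw [hνeq]; exact ⟨0, by ring⟩
  · exact ⟨haB, hbB, hcB⟩
  · rw [hμ2, ← hA, ← hB, ← hC, abs_of_pos hCpos, abs_of_pos hBpos, abs_of_pos hApos]
    refine ⟨by linarith, by linarith, by linarith, by linarith, by linarith, by linarith⟩
  · refine ⟨0, 0, ?_⟩
    rw [← hC]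
    simp only [Int.cast_zero, sub_zero]
    rw [e1, e2]
    exact sq_add_sq_le d1 d2 (by norm_num)
  · refine ⟨0, 0, ?_⟩
    rw [← hB]
    simp only [Int.cast_zero, sub_zero]
    rw [e3, e4]
    exact sq_add_sq_le d3 d4 (by norm_num)
  · refine ⟨0, 0, ?_⟩
    rw [← hA]
    simp only [Int.cast_zero, sub_zero]
    rw [e5, e6]
    exact sq_add_sq_le d5 d6 (by norm_num)

end Welsh2018

end Literature.NumberTheory.Sieve
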